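import Mathlib

/-!
HONEST FRAMING: exact (Metropolis-corrected) sampling algorithms for lattice gauge theory; figures
of merit are autocorrelation/cost numbers at stated couplings and volumes; no continuum-physics
claim.

# SwapLadderIndexTauIntThresholdMajorant — THE ANALYTIC CORE OF THE ALL-`K` THRESHOLD BOUND: AN ANTITONE MAJORANT
# `M(t)` (STEP FUNCTION ON `[1/20, 1]`, `0.88·t^{−1/4}` BELOW `1/20`) WITH `∫_0^1 M ≤ 0.3711` AND THE RIEMANN BOUND
# `Σ_{i=1}^{m} M(i/N) ≤ N·∫_0^{m/N} M ≤ 0.3711·N` (`m ≤ N`) (row 22 `su3-ptbc`, GEN-8, ours; Mathlib only)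

Venture `LatticeQCDFlow` (cell pub-lqcd), topic `Scaling`; FANOUT row 22 (`su3-ptbc`).  NEW WORK of the cell, Mathlib only
(`Real.rpow`, `intervalIntegral`, `integral_rpow`, `IntervalIntegrable.mono_fun'`, `setIntegral_mono_on`); nothing is
cited as a fact; no `native_decide`.  This file contains NO statement about swap ladders: it is the real-analysis half
of `SwapLadderIndexTauIntThresholdAllK` (the sequel, which imports `SwapLadderIndexTauIntCritGap` and
`SwapLadderIndexTauIntThresholdPoints`), kept separate so that it depends on long-built modules only.

THE POINT.  The collapse threshold of the `τ_int`-optimal ladder is `Λ_c(K) = Σ_{j<K} critGap((w_max/w_j)²)` with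
`(w_max/w_j)² ≤ (4t(1−t))^{−2}`, `t = (j+1)/(K+1)`; the seven certified points of `SwapLadderIndexTauIntThresholdPoints`
bound `critGap((4t(1−t))^{−2})/(2√2)` by a STEP FUNCTION of `t` on `[1/20, 1/2]` (`0.1, 0.3, 0.4, 0.6, 0.85, 1, 1.4` below the
thresholds `0.35, 0.23, 0.2, 0.15, 0.1, 0.078, 0.05`), and the Mills route bounds it by `√(log R) ≤ 0.88·t^{−1/4}` below
`t = 1/20`.  Here that majorant is studied on its own:
* §1 `tailMajorant t = 0.88·t^{−1/4}`, `stepMajorant` (a constant plus six indicator increments), **`indexMajorant`** (tail for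
  `t ≤ 1/20`, step above); `1/10 ≤ step ≤ 7/5 ≤ tail` on `(0, 1/20]` (`t^{−1/4} ≥ 2` there); **`antitoneOn_indexMajorant`**
  (antitone on `(0, ∞)`); band-wise LOWER bounds `stepMajorant_ge_of_lt_*`, `le_indexMajorant_of_le_step`,
  `indexMajorant_of_le` (used by the sequel to dominate `critGap`).
* §2 band-wise UPPER bounds `stepMajorant_le_of_ge_*`, measurability, and **`intervalIntegrable_indexMajorant`** on every
  `[a, b] ⊂ [0, ∞)` (dominated by `0.88·t^{−1/4} + 7/5`, exponent `−1/4 > −1`).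
* §3 **`mul_indexMajorant_le_integral`** (`(b−a)·M(b) ≤ ∫_a^b M`, one Riemann cell, from antitonicity on the half-open
  cell), **`sum_indexMajorant_le_integral`** (`Σ_{i=1}^{m} M(i/N) ≤ N·∫_0^{m/N} M`), `integral_indexMajorant_tail`
  (`∫_0^{1/20} M = (22/25)(4/3)(1/20)^{3/4}`, `integral_rpow`), `rpow_twentieth_le` (`(1/20)^{3/4} ≤ 0.106`),
  **`integral_indexMajorant_le`** (`∫_0^1 M ≤ 0.3711`: tail `≤ 0.1244` + seven bands `≤ 0.2467`), and the packaged
  **`sum_indexMajorant_le`**: `Σ_{i=1}^{m} M(i/N) ≤ 0.3711·N` for `m ≤ N`.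
NOT CLAIMED: anything about PTBC or a run; optimality of the constants (`2·0.3711·(K+1) < 0.905·K` for `K ≥ 5` suffices).
-/

noncomputable section

open Real Set MeasureTheory intervalIntegral

namespace Summit.Ventures.LatticeQCDFlow.Scaling

/-! ## §1 The majorant -/

section Majorant

/-- The tail majorant `0.88·t^{−1/4}`. [ours] -/
def tailMajorant (t : ℝ) : ℝ := 22 / 25 * t ^ (-(1 / 4 : ℝ))

/-- The step majorant: `1/10` plus the increments `1/5, 1/10, 1/5, 1/4, 3/20, 2/5` switched on below
`7/20, 23/100, 1/5, 3/20, 1/10, 39/500` (values `0.1, 0.3, 0.4, 0.6, 0.85, 1, 1.4` band by band). [ours] -/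
def stepMajorant (t : ℝ) : ℝ :=
  1 / 10 + (if t < 7 / 20 then 1 / 5 else 0) + (if t < 23 / 100 then 1 / 10 else 0) + (if t < 1 / 5 then 1 / 5 else 0)
    + (if t < 3 / 20 then 1 / 4 else 0) + (if t < 1 / 10 then 3 / 20 else 0) + (if t < 39 / 500 then 2 / 5 else 0)

/-- **The majorant**: the tail below `1/20`, the step function above. [ours] -/
def indexMajorant (t : ℝ) : ℝ := if t ≤ 1 / 20 then tailMajorant t else stepMajorant t

/-- A switched-on nonnegative increment is antitone in `t`. [folklore] -/
theorem ite_lt_antitone {c r : ℝ} (hr : 0 ≤ r) : Antitone fun t : ℝ => if t < c then r else (0 : ℝ) := by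
  intro a b hab
  show (if b < c then r else 0) ≤ (if a < c then r else 0)
  split_ifs <;> first | exact le_rfl | exact hr | (exfalso; linarith)

/-- `1/10 ≤ stepMajorant t ≤ 7/5`. [ours] -/
theorem stepMajorant_mem (t : ℝ) : stepMajorant t ∈ Icc (1 / 10 : ℝ) (7 / 5) := by
  unfold stepMajorant
  constructor <;> split_ifs <;> norm_num

/-- The step majorant is antitone. [ours] -/
theorem antitone_stepMajorant : Antitone stepMajorant := by
  intro a b hab
  unfold stepMajorant
  have h1 := ite_lt_antitone (c := 7 / 20) (r := 1 / 5) (by norm_num) hab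
  have h2 := ite_lt_antitone (c := 23 / 100) (r := 1 / 10) (by norm_num) hab
  have h3 := ite_lt_antitone (c := 1 / 5) (r := 1 / 5) (by norm_num) hab
  have h4 := ite_lt_antitone (c := 3 / 20) (r := 1 / 4) (by norm_num) hab
  have h5 := ite_lt_antitone (c := 1 / 10) (r := 3 / 20) (by norm_num) hab
  have h6 := ite_lt_antitone (c := 39 / 500) (r := 2 / 5) (by norm_num) hab
  simp only at h1 h2 h3 h4 h5 h6
  linarith

/-- `t^{−1/4} ≥ 2` for `0 < t ≤ 1/20` (`2⁴ = 16 ≤ 20 ≤ 1/t`). [ours] -/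
theorem two_le_rpow_neg_quarter {t : ℝ} (ht0 : 0 < t) (ht : t ≤ 1 / 20) : 2 ≤ t ^ (-(1 / 4 : ℝ)) := by
  have h16 : (2 : ℝ) = (16 : ℝ) ^ ((1 / 4 : ℝ)) := by
    rw [show (16 : ℝ) = 2 ^ (4 : ℝ) by norm_num, ← rpow_mul (by norm_num)]; norm_num
  rw [h16, rpow_neg ht0.le, ← inv_rpow ht0.le]
  refine rpow_le_rpow (by norm_num) ?_ (by norm_num)
  rw [le_inv_comm₀ (by norm_num) ht0]
  linarith

/-- The tail dominates the step at the junction: `7/5 ≤ tailMajorant t` for `0 < t ≤ 1/20`. [ours] -/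
theorem stepMax_le_tailMajorant {t : ℝ} (ht0 : 0 < t) (ht : t ≤ 1 / 20) : (7 / 5 : ℝ) ≤ tailMajorant t := by
  unfold tailMajorant
  have := two_le_rpow_neg_quarter ht0 ht
  linarith

/-- The tail is antitone on `(0, ∞)`. [ours] -/
theorem tailMajorant_antitoneOn : AntitoneOn tailMajorant (Ioi 0) := by
  intro a ha b _ hab
  unfold tailMajorant
  have h := rpow_le_rpow_of_nonpos ha hab (by norm_num : -(1 / 4 : ℝ) ≤ 0)
  linarith

/-- **The majorant is antitone on `(0, ∞)`.** [ours] -/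
theorem antitoneOn_indexMajorant : AntitoneOn indexMajorant (Ioi 0) := by
  intro a ha b hb hab
  unfold indexMajorant
  by_cases hb' : b ≤ 1 / 20
  · have ha' : a ≤ 1 / 20 := hab.trans hb'
    rw [if_pos ha', if_pos hb']
    exact tailMajorant_antitoneOn ha hb hab
  · rw [if_neg hb']
    by_cases ha' : a ≤ 1 / 20
    · rw [if_pos ha']
      exact (stepMajorant_mem b).2.trans (stepMax_le_tailMajorant ha ha')
    · rw [if_neg ha']
      exact antitone_stepMajorant hab

/-- `indexMajorant ≥ 0` on `(0, ∞)`. [ours] -/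
theorem indexMajorant_nonneg {t : ℝ} (ht : 0 < t) : 0 ≤ indexMajorant t := by
  unfold indexMajorant
  split_ifs with h
  · exact le_trans (by norm_num) (stepMax_le_tailMajorant ht h)
  · exact le_trans (by norm_num) (stepMajorant_mem t).1

/-! ### Band values: lower bounds (used by the sequel), upper bounds (used for the integral) -/
/-- Below `1/20` the majorant is the tail. [ours] -/
theorem indexMajorant_of_le {t : ℝ} (ht : t ≤ 1 / 20) : indexMajorant t = 22 / 25 * t ^ (-(1 / 4 : ℝ)) := by
  unfold indexMajorant tailMajorant
  rw [if_pos ht]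

/-- Above `1/20` the majorant is the step. [ours] -/
theorem indexMajorant_of_gt {t : ℝ} (ht : 1 / 20 < t) : indexMajorant t = stepMajorant t := by
  unfold indexMajorant
  rw [if_neg (not_le.2 ht)]

/-- `1/10 ≤ indexMajorant t` for `t > 0`. [ours] -/
theorem tenth_le_indexMajorant {t : ℝ} (ht : 0 < t) : 1 / 10 ≤ indexMajorant t := by
  unfold indexMajorant
  split_ifs with h
  · exact le_trans (by norm_num) (stepMax_le_tailMajorant ht h)
  · exact (stepMajorant_mem t).1

/-- `t < 0.35 ⇒ 3/10 ≤ step`. [ours] -/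
theorem stepMajorant_ge_of_lt_35 {t : ℝ} (ht : t < 7 / 20) : 3 / 10 ≤ stepMajorant t := by
  unfold stepMajorant; split_ifs <;> linarith

/-- `t < 0.23 ⇒ 2/5 ≤ step`. [ours] -/
theorem stepMajorant_ge_of_lt_23 {t : ℝ} (ht : t < 23 / 100) : 2 / 5 ≤ stepMajorant t := by
  unfold stepMajorant; split_ifs <;> linarith

/-- `t < 0.2 ⇒ 3/5 ≤ step`. [ours] -/
theorem stepMajorant_ge_of_lt_20 {t : ℝ} (ht : t < 1 / 5) : 3 / 5 ≤ stepMajorant t := by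
  unfold stepMajorant; split_ifs <;> linarith

/-- `t < 0.15 ⇒ 17/20 ≤ step`. [ours] -/
theorem stepMajorant_ge_of_lt_15 {t : ℝ} (ht : t < 3 / 20) : 17 / 20 ≤ stepMajorant t := by
  unfold stepMajorant; split_ifs <;> linarith

/-- `t < 0.1 ⇒ 1 ≤ step`. [ours] -/
theorem stepMajorant_ge_of_lt_10 {t : ℝ} (ht : t < 1 / 10) : 1 ≤ stepMajorant t := by
  unfold stepMajorant; split_ifs <;> linarith

/-- `t < 0.078 ⇒ 7/5 ≤ step`. [ours] -/
theorem stepMajorant_ge_of_lt_078 {t : ℝ} (ht : t < 39 / 500) : 7 / 5 ≤ stepMajorant t := by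
  unfold stepMajorant; split_ifs <;> linarith

/-- Transfer of a step lower bound to the majorant (`t > 0`; below `1/20` the tail is even larger). [ours] -/
theorem le_indexMajorant_of_le_step {t x : ℝ} (ht : 0 < t) (hx : x ≤ 7 / 5) (h : x ≤ stepMajorant t) :
    x ≤ indexMajorant t := by
  unfold indexMajorant
  split_ifs with h'
  · exact hx.trans (stepMax_le_tailMajorant ht h')
  · exact h

/-- `t ≥ 39/500 ⇒ step ≤ 1`. [ours] -/
theorem stepMajorant_le_of_ge_078 {t : ℝ} (ht : 39 / 500 ≤ t) : stepMajorant t ≤ 1 := by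
  unfold stepMajorant; split_ifs <;> linarith

/-- `t ≥ 1/10 ⇒ step ≤ 17/20`. [ours] -/
theorem stepMajorant_le_of_ge_10 {t : ℝ} (ht : 1 / 10 ≤ t) : stepMajorant t ≤ 17 / 20 := by
  unfold stepMajorant; split_ifs <;> linarith

/-- `t ≥ 3/20 ⇒ step ≤ 3/5`. [ours] -/
theorem stepMajorant_le_of_ge_15 {t : ℝ} (ht : 3 / 20 ≤ t) : stepMajorant t ≤ 3 / 5 := by
  unfold stepMajorant; split_ifs <;> linarith

/-- `t ≥ 1/5 ⇒ step ≤ 2/5`. [ours] -/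
theorem stepMajorant_le_of_ge_20 {t : ℝ} (ht : 1 / 5 ≤ t) : stepMajorant t ≤ 2 / 5 := by
  unfold stepMajorant; split_ifs <;> linarith

/-- `t ≥ 23/100 ⇒ step ≤ 3/10`. [ours] -/
theorem stepMajorant_le_of_ge_23 {t : ℝ} (ht : 23 / 100 ≤ t) : stepMajorant t ≤ 3 / 10 := by
  unfold stepMajorant; split_ifs <;> linarith

/-- `t ≥ 7/20 ⇒ step ≤ 1/10` (in fact `=`). [ours] -/
theorem stepMajorant_le_of_ge_35 {t : ℝ} (ht : 7 / 20 ≤ t) : stepMajorant t ≤ 1 / 10 := by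
  unfold stepMajorant; split_ifs <;> linarith

end Majorant

/-! ## §2 Measurability and integrability -/

section Bounds

/-- The step majorant is measurable. [ours] -/
theorem measurable_stepMajorant : Measurable stepMajorant := by
  unfold stepMajorant
  refine ((((((measurable_const.add ?_).add ?_).add ?_).add ?_).add ?_).add ?_) <;>
    exact Measurable.ite measurableSet_Iio measurable_const measurable_const

/-- The tail majorant is measurable. [ours] -/
theorem measurable_tailMajorant : Measurable tailMajorant := by
  unfold tailMajorant
  exact (measurable_id.pow_const _).const_mul _

/-- The majorant is measurable. [ours] -/
theorem measurable_indexMajorant : Measurable indexMajorant := by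
  have h : indexMajorant = fun t => if t ≤ 1 / 20 then tailMajorant t else stepMajorant t := rfl
  rw [h]
  exact Measurable.ite measurableSet_Iic measurable_tailMajorant measurable_stepMajorant

/-- On `(0, ∞)`: `indexMajorant t ≤ tailMajorant t + 7/5`. [ours] -/
theorem indexMajorant_le_dom {t : ℝ} (ht : 0 < t) : indexMajorant t ≤ tailMajorant t + 7 / 5 := by
  have htail : 0 ≤ tailMajorant t := by
    unfold tailMajorant; exact mul_nonneg (by norm_num) (rpow_nonneg ht.le _)
  unfold indexMajorant
  split_ifs with h
  · linarith
  · linarith [(stepMajorant_mem t).2]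

/-- **The majorant is interval-integrable on every `[a, b] ⊂ [0, ∞)`** (dominated by `0.88·t^{−1/4} + 7/5`). [ours] -/
theorem intervalIntegrable_indexMajorant {a b : ℝ} (ha : 0 ≤ a) (hb : 0 ≤ b) :
    IntervalIntegrable indexMajorant volume a b := by
  have hg : IntervalIntegrable (fun t => tailMajorant t + 7 / 5) volume a b := by
    unfold tailMajorant
    exact ((intervalIntegral.intervalIntegrable_rpow' (by norm_num)).const_mul _).add intervalIntegrable_const
  refine hg.mono_fun' measurable_indexMajorant.aestronglyMeasurable ?_
  rw [Filter.EventuallyLE, ae_restrict_iff' measurableSet_uIoc]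
  refine ae_of_all _ fun t ht => ?_
  have ht0 : 0 < t := by
    have := ht.1
    rcases le_total a b with hab | hab
    · rw [min_eq_left hab] at this; linarith
    · rw [min_eq_right hab] at this; linarith
  rw [Real.norm_eq_abs, abs_of_nonneg (indexMajorant_nonneg ht0)]
  exact indexMajorant_le_dom ht0

end Bounds

/-! ## §3 The Riemann bound `Σ_{i=1}^{m} M(i/N) ≤ N·∫_0^{m/N} M` and `∫_0^1 M ≤ 0.3711` -/

section Riemann

/-- **One cell**: for `0 ≤ a ≤ b`, `(b − a)·M(b) ≤ ∫_a^b M` (the majorant is antitone on `(0, ∞)`). [ours] -/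
theorem mul_indexMajorant_le_integral {a b : ℝ} (ha : 0 ≤ a) (hab : a ≤ b) :
    (b - a) * indexMajorant b ≤ ∫ t in a..b, indexMajorant t := by
  rcases hab.eq_or_lt with rfl | hlt
  · simp
  have hb : 0 < b := lt_of_le_of_lt ha hlt
  rw [intervalIntegral.integral_of_le hab]
  have hI : IntegrableOn indexMajorant (Ioc a b) := (intervalIntegrable_indexMajorant ha hb.le).1
  have hc : IntegrableOn (fun _ : ℝ => indexMajorant b) (Ioc a b) := continuous_const.integrableOn_Ioc
  calc (b - a) * indexMajorant b = ∫ _ in Ioc a b, indexMajorant b := by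
        rw [setIntegral_const, Measure.real, Real.volume_Ioc, ENNReal.toReal_ofReal (by linarith), smul_eq_mul]
    _ ≤ ∫ t in Ioc a b, indexMajorant t := by
        refine setIntegral_mono_on hc hI measurableSet_Ioc fun t ht => ?_
        exact antitoneOn_indexMajorant (lt_of_le_of_lt ha ht.1) hb ht.2

/-- **The Riemann bound: `Σ_{i=1}^{m} M(i/N) ≤ N·∫_0^{m/N} M`** (`N ≥ 1`). [ours] -/
theorem sum_indexMajorant_le_integral {N : ℕ} (hN : 0 < N) (m : ℕ) :
    ∑ i ∈ Finset.Icc 1 m, indexMajorant ((i : ℝ) / N) ≤ N * ∫ t in (0 : ℝ)..((m : ℝ) / N), indexMajorant t := by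
  have hN' : (0 : ℝ) < N := by exact_mod_cast hN
  induction m with
  | zero => simp
  | succ m ih =>
    rw [Finset.sum_Icc_succ_top (by omega), Nat.cast_succ]
    have hm0 : (0 : ℝ) ≤ (m : ℝ) / N := by positivity
    have hstep : (m : ℝ) / N ≤ ((m : ℝ) + 1) / N := by gcongr; linarith
    have hcell := mul_indexMajorant_le_integral hm0 hstep
    have e : ((m : ℝ) + 1) / N - (m : ℝ) / N = 1 / N := by field_simp; ring
    rw [e] at hcell
    have hsplit : ∫ t in (0 : ℝ)..((m : ℝ) + 1) / N, indexMajorant t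
        = (∫ t in (0 : ℝ)..(m : ℝ) / N, indexMajorant t) + ∫ t in ((m : ℝ) / N)..((m : ℝ) + 1) / N, indexMajorant t :=
      (intervalIntegral.integral_add_adjacent_intervals (intervalIntegrable_indexMajorant le_rfl hm0)
        (intervalIntegrable_indexMajorant hm0 (by positivity))).symm
    rw [hsplit, mul_add]
    have h2 : indexMajorant (((m : ℝ) + 1) / N) ≤ N * ∫ t in ((m : ℝ) / N)..((m : ℝ) + 1) / N, indexMajorant t := by
      have := mul_le_mul_of_nonneg_left hcell hN'.le
      rwa [← mul_assoc, mul_one_div_cancel hN'.ne', one_mul] at this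
    linarith

/-- `∫_0^{1/20} M = (22/25)·(4/3)·(1/20)^{3/4}` (the tail). [ours] -/
theorem integral_indexMajorant_tail :
    ∫ t in (0 : ℝ)..(1 / 20), indexMajorant t = 22 / 25 * ((1 / 20 : ℝ) ^ (3 / 4 : ℝ) / (3 / 4)) := by
  have hcongr : ∫ t in (0 : ℝ)..(1 / 20), indexMajorant t = ∫ t in (0 : ℝ)..(1 / 20), 22 / 25 * t ^ (-(1 / 4 : ℝ)) := by
    refine intervalIntegral.integral_congr fun t ht => ?_
    rw [uIcc_of_le (by norm_num)] at ht
    exact indexMajorant_of_le ht.2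
  rw [hcongr, intervalIntegral.integral_const_mul, integral_rpow (Or.inl (by norm_num))]
  rw [Real.zero_rpow (by norm_num)]
  norm_num

/-- `(1/20)^{3/4} ≤ 0.106` (`(1/20)³ ≤ 0.106⁴`). [ours] -/
theorem rpow_twentieth_le : (1 / 20 : ℝ) ^ (3 / 4 : ℝ) ≤ 0.106 := by
  have h4 : ((1 / 20 : ℝ) ^ (3 / 4 : ℝ)) ^ (4 : ℕ) = (1 / 20 : ℝ) ^ (3 : ℕ) := by
    rw [← Real.rpow_natCast, ← Real.rpow_mul (by norm_num)]
    norm_num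
  have hx : 0 ≤ (1 / 20 : ℝ) ^ (3 / 4 : ℝ) := rpow_nonneg (by norm_num) _
  by_contra hcon
  rw [not_le] at hcon
  have := pow_lt_pow_left₀ hcon (by norm_num) (by norm_num : (4 : ℕ) ≠ 0)
  rw [h4] at this
  norm_num at this

/-- **`∫_0^1 M ≤ 0.3711`**: the tail contributes `≤ (22/25)(4/3)(0.106) < 0.1244`, the step part at most
`1.4·0.028 + 1·0.022 + 0.85·0.05 + 0.6·0.05 + 0.4·0.03 + 0.3·0.12 + 0.1·0.65 = 0.2467`. [ours] -/
theorem integral_indexMajorant_le : ∫ t in (0 : ℝ)..1, indexMajorant t ≤ 0.3711 := by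
  have hii : ∀ {a b : ℝ}, 0 ≤ a → 0 ≤ b → IntervalIntegrable indexMajorant volume a b :=
    fun ha hb => intervalIntegrable_indexMajorant ha hb
  -- band bounds: `∫_a^b M ≤ v (b − a)` when `step ≤ v` on `(a, b]`, `a ≥ 1/20` (there `M = step`; a.e. form, the left
  -- endpoint `a = 1/20` itself carries the tail value)
  have band : ∀ {a b v : ℝ}, 1 / 20 ≤ a → a ≤ b → (∀ t, a < t → t ≤ b → stepMajorant t ≤ v) →
      ∫ t in a..b, indexMajorant t ≤ v * (b - a) := by
    intro a b v ha hab hv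
    have h := intervalIntegral.integral_mono_ae_restrict hab (hii (by linarith) (by linarith))
      (intervalIntegrable_const (c := v)) (by
        have hae : (volume : Measure ℝ).restrict (Icc a b) = volume.restrict (Ioc a b) :=
          Measure.restrict_congr_set Ioc_ae_eq_Icc.symm
        rw [Filter.EventuallyLE, hae, ae_restrict_iff' measurableSet_Ioc]
        refine ae_of_all _ fun t ht => ?_
        rw [indexMajorant_of_gt (lt_of_le_of_lt ha ht.1)]
        exact hv t ht.1 ht.2)
    rwa [intervalIntegral.integral_const, smul_eq_mul, mul_comm] at h
  have s1 : ∫ t in (1 / 20 : ℝ)..(39 / 500), indexMajorant t ≤ 7 / 5 * (39 / 500 - 1 / 20) :=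
    band (by norm_num) (by norm_num) fun t _ _ => (stepMajorant_mem t).2
  have s2 : ∫ t in (39 / 500 : ℝ)..(1 / 10), indexMajorant t ≤ 1 * (1 / 10 - 39 / 500) :=
    band (by norm_num) (by norm_num) fun t h _ => stepMajorant_le_of_ge_078 h.le
  have s3 : ∫ t in (1 / 10 : ℝ)..(3 / 20), indexMajorant t ≤ 17 / 20 * (3 / 20 - 1 / 10) :=
    band (by norm_num) (by norm_num) fun t h _ => stepMajorant_le_of_ge_10 h.le
  have s4 : ∫ t in (3 / 20 : ℝ)..(1 / 5), indexMajorant t ≤ 3 / 5 * (1 / 5 - 3 / 20) :=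
    band (by norm_num) (by norm_num) fun t h _ => stepMajorant_le_of_ge_15 h.le
  have s5 : ∫ t in (1 / 5 : ℝ)..(23 / 100), indexMajorant t ≤ 2 / 5 * (23 / 100 - 1 / 5) :=
    band (by norm_num) (by norm_num) fun t h _ => stepMajorant_le_of_ge_20 h.le
  have s6 : ∫ t in (23 / 100 : ℝ)..(7 / 20), indexMajorant t ≤ 3 / 10 * (7 / 20 - 23 / 100) :=
    band (by norm_num) (by norm_num) fun t h _ => stepMajorant_le_of_ge_23 h.le
  have s7 : ∫ t in (7 / 20 : ℝ)..1, indexMajorant t ≤ 1 / 10 * (1 - 7 / 20) :=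
    band (by norm_num) (by norm_num) fun t h _ => stepMajorant_le_of_ge_35 h.le
  have htail : ∫ t in (0 : ℝ)..(1 / 20), indexMajorant t ≤ 22 / 25 * (0.106 / (3 / 4)) := by
    rw [integral_indexMajorant_tail]
    have := rpow_twentieth_le
    gcongr
  -- glue the pieces
  have e : ∫ t in (0 : ℝ)..1, indexMajorant t
      = (∫ t in (0 : ℝ)..(1 / 20), indexMajorant t) + (∫ t in (1 / 20 : ℝ)..(39 / 500), indexMajorant t)
        + (∫ t in (39 / 500 : ℝ)..(1 / 10), indexMajorant t) + (∫ t in (1 / 10 : ℝ)..(3 / 20), indexMajorant t)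
        + (∫ t in (3 / 20 : ℝ)..(1 / 5), indexMajorant t) + (∫ t in (1 / 5 : ℝ)..(23 / 100), indexMajorant t)
        + (∫ t in (23 / 100 : ℝ)..(7 / 20), indexMajorant t) + (∫ t in (7 / 20 : ℝ)..1, indexMajorant t) := by
    rw [intervalIntegral.integral_add_adjacent_intervals (hii (by norm_num) (by norm_num)) (hii (by norm_num) (by norm_num)),
      intervalIntegral.integral_add_adjacent_intervals (hii (by norm_num) (by norm_num)) (hii (by norm_num) (by norm_num)),
      intervalIntegral.integral_add_adjacent_intervals (hii (by norm_num) (by norm_num)) (hii (by norm_num) (by norm_num)),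
      intervalIntegral.integral_add_adjacent_intervals (hii (by norm_num) (by norm_num)) (hii (by norm_num) (by norm_num)),
      intervalIntegral.integral_add_adjacent_intervals (hii (by norm_num) (by norm_num)) (hii (by norm_num) (by norm_num)),
      intervalIntegral.integral_add_adjacent_intervals (hii (by norm_num) (by norm_num)) (hii (by norm_num) (by norm_num)),
      intervalIntegral.integral_add_adjacent_intervals (hii (by norm_num) (by norm_num)) (hii (by norm_num) (by norm_num))]
  rw [e]
  norm_num at s1 s2 s3 s4 s5 s6 s7 htail ⊢
  linarith

/-- `∫_0^x M ≤ ∫_0^1 M` for `0 ≤ x ≤ 1` (the majorant is nonnegative). [ours] -/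
theorem integral_indexMajorant_mono {x : ℝ} (hx0 : 0 ≤ x) (hx1 : x ≤ 1) :
    ∫ t in (0 : ℝ)..x, indexMajorant t ≤ ∫ t in (0 : ℝ)..1, indexMajorant t := by
  rw [← intervalIntegral.integral_add_adjacent_intervals (intervalIntegrable_indexMajorant le_rfl hx0)
    (intervalIntegrable_indexMajorant hx0 zero_le_one)]
  have h : 0 ≤ ∫ t in x..1, indexMajorant t := by
    refine intervalIntegral.integral_nonneg hx1 fun t ht => ?_
    rcases (hx0.trans ht.1).eq_or_lt with h0 | hpos
    · rw [← h0, indexMajorant_of_le (by norm_num), Real.zero_rpow (by norm_num)]; norm_num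
    · exact indexMajorant_nonneg hpos
  linarith

/-- **THE PACKAGED BOUND: `Σ_{i=1}^{m} M(i/N) ≤ 0.3711·N` for `1 ≤ N`, `m ≤ N`.** [ours] -/
theorem sum_indexMajorant_le {N m : ℕ} (hN : 0 < N) (hm : m ≤ N) :
    ∑ i ∈ Finset.Icc 1 m, indexMajorant ((i : ℝ) / N) ≤ 0.3711 * N := by
  have hN' : (0 : ℝ) < N := by exact_mod_cast hN
  have h1 := sum_indexMajorant_le_integral hN m
  have hx1 : (m : ℝ) / N ≤ 1 := by
    rw [div_le_one hN']; exact_mod_cast hm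
  have h2 := integral_indexMajorant_mono (by positivity : (0 : ℝ) ≤ (m : ℝ) / N) hx1
  have h3 := integral_indexMajorant_le
  nlinarith

end Riemann

end Summit.Ventures.LatticeQCDFlow.Scaling

end
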